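import Summits.ValiantsHypothesis.ValiantsHypothesis.Theorems.KPlusLogSqLawTropicalBMarkedEdgeDual
import Summits.ValiantsHypothesis.ValiantsHypothesis.Theorems.KPlusLogSqLawTropicalBMarkedEdgeFourBitDominant

/-!
# Route «KPlusLogSqLaw», crux `TropicalB` (stmt-ValiantsHypothesis-19771) — MARKED-EDGE sector, FOUR-BIT LAW, part 8:
# the DUAL LAW in the tree's currency and «AT MOST 14 OF THE 16 PATTERNS» (V(·,4) ≤ 14 on every number of nodes)

HONEST FRAMING.  Helper file (cell `pub-symmetroid`, seat val-sym-trop-p4 (g16), 2026-08-28; `--supports stmt-ValiantsHypothesis-19771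
--as helper`).  Last file of the kernel version of g15's THEOREM-FOURBIT.md: §5 Corollary 3 (dual law) and Corollary 4 (upper side of
`V(·,4) = 14`) read for the cell's dominance designs (`IsDominant`).  Together with `FourThree.markedEdge_six_four_fourteen` (p639688:
fourteen of sixteen attained on six nodes) this pins **`V(m,4) = 14` for every `m ≥ 6`** and `V(m,4) ≤ 14` for every `m`, in the kernel.  A
structure theorem of ONE sector; nothing here concerns general designs, `TropicalB` in its window, `WeakLifting`, the doors,
`MatrixDescartes` (stmt-ValiantsHypothesis-18050) or VP ≠ VNP.
* `dual_four_bit_law_static` — static dominance designs, four injectively marked diagonal cells with exponents `e₀ < e₁ < e₂`,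
  `e₁ + e₂ < e₃`, every other diagonal cell of exponent `0`, present off-diagonal cells of exponent `0`: no four dominant terms with the
  fixed-point patterns «`b 3` only» / «`b 1, b 2`» / «`b 0, b 2`» / «`b 0, b 1`» (any `m`, `K`, valuations, support, slopes `θ`).
* `markedEdge_dual_law` — the lineage's sector (format `(m,5)`, `d = (0,1,2,4,8)`, every `m ≥ 4`): used-marked-loop patterns
  `{3}, {1,2}, {0,2}, {0,1}` (slopes `8, 6, 5, 3`) are never simultaneously dominant.
* `markedEdge_card_le_fourteen` — in that sector, every set of patterns `x < 16` each realised by a dominant term (term uses the marked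
  loop `l` iff bit `l` of `x` is set) has at most `14` elements.
-/

set_option linter.dupNamespace false
set_option autoImplicit false

namespace Summit.ValiantsHypothesis.ValiantsHypothesis.Theorems.KPlusLogSqLaw
namespace MarkedEdge
namespace FourBit

open Finset
open Summit.ValiantsHypothesis.ValiantsHypothesis.Theorems.MatrixDescartes.Negative

variable {m K : ℕ}

/-- **THE DUAL LAW for static dominance designs** (tree currency).  Static design, present off-diagonal cells of exponent `0`, four
injectively marked diagonal cells `b 0, …, b 3` with exponents `e₀ < e₁ < e₂`, `e₁ + e₂ < e₃`, all other diagonal cells of exponent `0`.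
Then no four terms, dominant at four integer slopes, have the fixed-point patterns (among the marked cells) «`b 3` only», «`b 1, b 2`»,
«`b 0, b 2`», «`b 0, b 1`». [this seat's theorem; kernel version of THEOREM-FOURBIT.md §5 Cor. 3 in the cell's `IsDominant` vocabulary] -/
theorem dual_four_bit_law_static (d : Fin K → ℕ) (v ε : Fin m → Fin m → Fin K → ℤ) (cl : Fin m → Fin m → Fin K)
    (hstatic : ∀ i j l, ε i j l ≠ 0 → l = cl i j) (hoffd : ∀ i j, i ≠ j → ε i j (cl i j) ≠ 0 → d (cl i j) = 0)
    {b : Fin 4 → Fin m} (hb : Function.Injective b) (hctx0 : ∀ i, (∀ k, b k ≠ i) → d (cl i i) = 0)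
    (hs01 : d (cl (b 0) (b 0)) < d (cl (b 1) (b 1))) (hs12 : d (cl (b 1) (b 1)) < d (cl (b 2) (b 2)))
    (hs3 : d (cl (b 1) (b 1)) + d (cl (b 2) (b 2)) < d (cl (b 3) (b 3)))
    {θD θA θB θC : ℤ} {pD pA pB pC : Equiv.Perm (Fin m) × (Fin m → Fin K)}
    (hD : IsDominant d v ε θD pD) (hA : IsDominant d v ε θA pA) (hB : IsDominant d v ε θB pB) (hC : IsDominant d v ε θC pC)
    (hD0 : pD.1 (b 0) ≠ b 0) (hD1 : pD.1 (b 1) ≠ b 1) (hD2 : pD.1 (b 2) ≠ b 2) (hD3 : pD.1 (b 3) = b 3)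
    (hA0 : pA.1 (b 0) ≠ b 0) (hA1 : pA.1 (b 1) = b 1) (hA2 : pA.1 (b 2) = b 2) (hA3 : pA.1 (b 3) ≠ b 3)
    (hB0 : pB.1 (b 0) = b 0) (hB1 : pB.1 (b 1) ≠ b 1) (hB2 : pB.1 (b 2) = b 2) (hB3 : pB.1 (b 3) ≠ b 3)
    (hC0 : pC.1 (b 0) = b 0) (hC1 : pC.1 (b 1) = b 1) (hC2 : pC.1 (b 2) ≠ b 2) (hC3 : pC.1 (b 3) ≠ b 3) : False := by
  have hg : ∀ i : Fin m, (if i = i then (d (cl i i) : ℤ) else 0) = d (cl i i) := fun i => if_pos rfl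
  refine dual_four_bit_law (V := Fin m) (fun i j => ε j i (cl j i) ≠ 0) (fun i j => -v j i (cl j i))
    (fun i j => if j = i then (d (cl i i) : ℤ) else 0) hb (fun i j h => if_neg h)
    (fun i hm => by rw [hg]; exact_mod_cast hctx0 i hm) (by rw [hg]; positivity)
    (by rw [hg, hg]; exact_mod_cast hs01) (by rw [hg, hg]; exact_mod_cast hs12) (by rw [hg, hg, hg]; exact_mod_cast hs3)
    hD0 hD1 hD2 hD3 hA0 hA1 hA2 hA3 hB0 hB1 hB2 hB3 hC0 hC1 hC2 hC3
    (isMax_of_isDominant d v ε cl hstatic hoffd hD) (isMax_of_isDominant d v ε cl hstatic hoffd hA)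
    (isMax_of_isDominant d v ε cl hstatic hoffd hB) (isMax_of_isDominant d v ε cl hstatic hoffd hC)

/-- **THE DUAL LAW in the lineage's sector** (format `(m, 5)`, exponents `d = (0, 1, 2, 4, 8)`; a present class on cell `(i, j)` is class
`i + 1` if `i = j < 4`, class `0` otherwise; ANY support, ANY valuations, EVERY size `m ≥ 4`).  There are no four terms, dominant at four
integer slopes, whose sets of used marked loops are `{3}` (slope 8), `{1,2}` (6), `{0,2}` (5), `{0,1}` (3).
[this seat's theorem; kernel version of THEOREM-FOURBIT.md §5 Cor. 3] -/
theorem markedEdge_dual_law (m : ℕ) (hm : 4 ≤ m) (d : Fin 5 → ℕ)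
    (hd : ∀ l : Fin 5, d l = if (l : ℕ) = 0 then 0 else 2 ^ ((l : ℕ) - 1)) (v ε : Fin m → Fin m → Fin 5 → ℤ)
    (hsec : ∀ (i j : Fin m) (l : Fin 5), ε i j l ≠ 0 → (l : ℕ) = if i = j ∧ (i : ℕ) < 4 then (i : ℕ) + 1 else 0) :
    ¬ ∃ (θ : Fin 4 → ℤ) (p : Fin 4 → Equiv.Perm (Fin m) × (Fin m → Fin 5)),
      (∀ k, IsDominant d v ε (θ k) (p k)) ∧
      ∀ n : Fin m, (n : ℕ) < 4 →
        ((p 0).1 n = n ↔ (n : ℕ) = 3) ∧ ((p 1).1 n = n ↔ ((n : ℕ) = 1 ∨ (n : ℕ) = 2)) ∧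
        ((p 2).1 n = n ↔ ((n : ℕ) = 0 ∨ (n : ℕ) = 2)) ∧ ((p 3).1 n = n ↔ ((n : ℕ) = 0 ∨ (n : ℕ) = 1)) := by
  rintro ⟨θ, p, hdom, hpat⟩
  let cl : Fin m → Fin m → Fin 5 := fun i j => if h : i = j ∧ (i : ℕ) < 4 then ⟨(i : ℕ) + 1, by omega⟩ else 0
  have hclval : ∀ i j : Fin m, ((cl i j : Fin 5) : ℕ) = if i = j ∧ (i : ℕ) < 4 then (i : ℕ) + 1 else 0 := by
    intro i j
    by_cases h : i = j ∧ (i : ℕ) < 4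
    · simp only [cl, dif_pos h, if_pos h]
    · simp only [cl, dif_neg h, if_neg h, Fin.val_zero]
  have hstatic : ∀ i j l, ε i j l ≠ 0 → l = cl i j := fun i j l h => Fin.ext (by rw [hsec i j l h, hclval])
  have hoffd : ∀ i j : Fin m, i ≠ j → ε i j (cl i j) ≠ 0 → d (cl i j) = 0 := by
    intro i j hij _
    have : cl i j = 0 := dif_neg (show ¬ (i = j ∧ (i : ℕ) < 4) from fun h => hij h.1)
    rw [this, hd]; rfl
  -- the four marked nodes
  let b : Fin 4 → Fin m := fun l => ⟨(l : ℕ), by omega⟩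
  have hb : Function.Injective b := fun l l' h => Fin.ext (by simpa [b] using congrArg Fin.val h)
  have hdiag : ∀ l : Fin 4, d (cl (b l) (b l)) = 2 ^ (l : ℕ) := by
    intro l
    have hl : ((b l : Fin m) : ℕ) < 4 := by simp [b]
    have : cl (b l) (b l) = ⟨(l : ℕ) + 1, by omega⟩ := by
      simp only [cl, dif_pos (And.intro rfl hl)]; rfl
    rw [this, hd]
    simp
  have e0 : d (cl (b 0) (b 0)) = 1 := by rw [hdiag]; rfl
  have e1 : d (cl (b 1) (b 1)) = 2 := by rw [hdiag]; rfl
  have e2 : d (cl (b 2) (b 2)) = 4 := by rw [hdiag]; rfl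
  have e3 : d (cl (b 3) (b 3)) = 8 := by rw [hdiag]; rfl
  have hctx0 : ∀ i : Fin m, (∀ k, b k ≠ i) → d (cl i i) = 0 := by
    intro i hk
    have hi4 : ¬ (i : ℕ) < 4 := by
      intro hlt
      exact hk ⟨(i : ℕ), hlt⟩ (Fin.ext (by simp [b]))
    have : cl i i = 0 := dif_neg (show ¬ (i = i ∧ (i : ℕ) < 4) from fun h => hi4 h.2)
    rw [this, hd]; rfl
  -- patterns
  obtain ⟨q00, q10, q20, q30⟩ := hpat (b 0) (by simp [b])
  obtain ⟨q01, q11, q21, q31⟩ := hpat (b 1) (by simp [b])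
  obtain ⟨q02, q12, q22, q32⟩ := hpat (b 2) (by simp [b])
  obtain ⟨q03, q13, q23, q33⟩ := hpat (b 3) (by simp [b])
  simp only [b] at q00 q10 q20 q30 q01 q11 q21 q31 q02 q12 q22 q32 q03 q13 q23 q33
  norm_num at q00 q10 q20 q30 q01 q11 q21 q31 q02 q12 q22 q32 q03 q13 q23 q33
  exact dual_four_bit_law_static d v ε cl hstatic hoffd hb hctx0
    (by rw [e0, e1]; norm_num) (by rw [e1, e2]; norm_num) (by rw [e1, e2, e3]; norm_num)
    (hdom 0) (hdom 1) (hdom 2) (hdom 3)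
    q00 q01 q02 q03 q10 q11 q12 q13 q20 q21 q22 q23 q30 q31 q32 q33

/-- **AT MOST FOURTEEN OF THE SIXTEEN PATTERNS** (kernel version of THEOREM-FOURBIT.md §5 Cor. 4, upper side; the lower side is
`FourThree.markedEdge_six_four_fourteen`, p639688).  In the lineage's marked-edge sector (format `(m, 5)`, `d = (0,1,2,4,8)`, every
`m ≥ 4`, any support and valuations): if every pattern `x` in a set `S` of numbers `< 16` is REALISED — some term, dominant at some integer
slope, uses the marked loop `l < 4` iff bit `l` of `x` is set — then `S` has at most `14` elements: by `markedEdge_four_bit_law` one of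
`7, 9, 10, 12` is missing and by `markedEdge_dual_law` one of `3, 5, 6, 8`.  So four marked bits carry at most 14 upper-hull vertices on any
number of nodes, and exactly 14 from six nodes on. [this seat's theorem] -/
theorem markedEdge_card_le_fourteen (m : ℕ) (hm : 4 ≤ m) (d : Fin 5 → ℕ)
    (hd : ∀ l : Fin 5, d l = if (l : ℕ) = 0 then 0 else 2 ^ ((l : ℕ) - 1)) (v ε : Fin m → Fin m → Fin 5 → ℤ)
    (hsec : ∀ (i j : Fin m) (l : Fin 5), ε i j l ≠ 0 → (l : ℕ) = if i = j ∧ (i : ℕ) < 4 then (i : ℕ) + 1 else 0)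
    (S : Finset (Fin 16))
    (hS : ∀ x ∈ S, ∃ (θ : ℤ) (p : Equiv.Perm (Fin m) × (Fin m → Fin 5)), IsDominant d v ε θ p ∧
      ∀ n : Fin m, (n : ℕ) < 4 → (p.1 n = n ↔ Nat.testBit (x : ℕ) (n : ℕ) = true)) :
    S.card ≤ 14 := by
  -- bits of the eight patterns at nodes `n < 4`
  have bits : ∀ n : ℕ, n < 4 →
      ((Nat.testBit 7 n = true ↔ n ≠ 3) ∧ (Nat.testBit 9 n = true ↔ (n = 0 ∨ n = 3)) ∧
       (Nat.testBit 10 n = true ↔ (n = 1 ∨ n = 3)) ∧ (Nat.testBit 12 n = true ↔ (n = 2 ∨ n = 3))) ∧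
      ((Nat.testBit 8 n = true ↔ n = 3) ∧ (Nat.testBit 6 n = true ↔ (n = 1 ∨ n = 2)) ∧
       (Nat.testBit 5 n = true ↔ (n = 0 ∨ n = 2)) ∧ (Nat.testBit 3 n = true ↔ (n = 0 ∨ n = 1))) := by
    intro n hn
    interval_cases n <;> decide
  -- one of 7, 9, 10, 12 is missing
  have miss1 : ¬ ((7 : Fin 16) ∈ S ∧ (9 : Fin 16) ∈ S ∧ (10 : Fin 16) ∈ S ∧ (12 : Fin 16) ∈ S) := by
    rintro ⟨h7, h9, h10, h12⟩
    obtain ⟨θ₀, p₀, d₀, b₀⟩ := hS 7 h7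
    obtain ⟨θ₁, p₁, d₁, b₁⟩ := hS 9 h9
    obtain ⟨θ₂, p₂, d₂, b₂⟩ := hS 10 h10
    obtain ⟨θ₃, p₃, d₃, b₃⟩ := hS 12 h12
    refine markedEdge_four_bit_law m hm d hd v ε hsec ⟨![θ₀, θ₁, θ₂, θ₃], ![p₀, p₁, p₂, p₃], ?_, fun n hn => ?_⟩
    · intro k; fin_cases k; exacts [d₀, d₁, d₂, d₃]
    · obtain ⟨⟨e7, e9, e10, e12⟩, -⟩ := bits n hn
      refine ⟨?_, ?_, ?_, ?_⟩
      · exact (b₀ n hn).trans e7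
      · exact (b₁ n hn).trans e9
      · exact (b₂ n hn).trans e10
      · exact (b₃ n hn).trans e12
  -- one of 8, 6, 5, 3 is missing
  have miss2 : ¬ ((8 : Fin 16) ∈ S ∧ (6 : Fin 16) ∈ S ∧ (5 : Fin 16) ∈ S ∧ (3 : Fin 16) ∈ S) := by
    rintro ⟨h8, h6, h5, h3⟩
    obtain ⟨θ₀, p₀, d₀, b₀⟩ := hS 8 h8
    obtain ⟨θ₁, p₁, d₁, b₁⟩ := hS 6 h6
    obtain ⟨θ₂, p₂, d₂, b₂⟩ := hS 5 h5
    obtain ⟨θ₃, p₃, d₃, b₃⟩ := hS 3 h3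
    refine markedEdge_dual_law m hm d hd v ε hsec ⟨![θ₀, θ₁, θ₂, θ₃], ![p₀, p₁, p₂, p₃], ?_, fun n hn => ?_⟩
    · intro k; fin_cases k; exacts [d₀, d₁, d₂, d₃]
    · obtain ⟨-, e8, e6, e5, e3⟩ := bits n hn
      refine ⟨?_, ?_, ?_, ?_⟩
      · exact (b₀ n hn).trans e8
      · exact (b₁ n hn).trans e6
      · exact (b₂ n hn).trans e5
      · exact (b₃ n hn).trans e3
  -- hence two distinct patterns are missing
  have hx : ∃ x ∈ ({7, 9, 10, 12} : Finset (Fin 16)), x ∉ S := by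
    by_contra h
    push Not at h
    exact miss1 ⟨h 7 (by decide), h 9 (by decide), h 10 (by decide), h 12 (by decide)⟩
  have hy : ∃ y ∈ ({8, 6, 5, 3} : Finset (Fin 16)), y ∉ S := by
    by_contra h
    push Not at h
    exact miss2 ⟨h 8 (by decide), h 6 (by decide), h 5 (by decide), h 3 (by decide)⟩
  obtain ⟨x, hx, hxS⟩ := hx
  obtain ⟨y, hy, hyS⟩ := hy
  have hxy : x ≠ y := by
    rintro rfl
    simp only [Finset.mem_insert, Finset.mem_singleton] at hx hy
    rcases hx with rfl | rfl | rfl | rfl <;> revert hy <;> decide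
  have hsub : S ⊆ (Finset.univ.erase x).erase y := by
    intro z hz
    rw [Finset.mem_erase, Finset.mem_erase]
    exact ⟨fun h => hyS (h ▸ hz), fun h => hxS (h ▸ hz), Finset.mem_univ z⟩
  have := Finset.card_le_card hsub
  rw [Finset.card_erase_of_mem (Finset.mem_erase.mpr ⟨Ne.symm hxy, Finset.mem_univ y⟩),
    Finset.card_erase_of_mem (Finset.mem_univ x), Finset.card_univ, Fintype.card_fin] at this
  exact this

end FourBit
end MarkedEdge
end Summit.ValiantsHypothesis.ValiantsHypothesis.Theorems.KPlusLogSqLaw
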